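import Summits.HodgeConjecture.HodgeConjecture.Theorems.NikulinTwinTransportRealMultiplicationGlueOfTwoSelfSimilar
import Summits.HodgeConjecture.HodgeConjecture.Theorems.NikulinTwinTransportAlgebraicClassesOneOneK3CurveKernel
import Literature.AlgebraicGeometry.Surfaces.K3HodgeTypesHolds

/-!
# Route NikulinTwinTransport · `RealMultiplicationSqrtTwoAlgebraic` (stmt-HodgeConjecture-13679) —
# the item from X and the rational `2`-self-similitude of `H²(K3)` ALONE (no Lefschetz `(1,1)`,
# no marking, no named fact)

State of the item before this file. The route decl `RealMultiplicationSqrtTwoAlgebraic` (real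
multiplication by `√2` on the transcendental part of `H²` of a projective K3 surface is algebraic)
was derived in the tree

* from X = `TwinSimilitudeAlgebraic` + THREE named facts (`realMultiplicationSqrtTwoAlgebraic_of_facts`:
  `Huybrechts_K3_marking_exists`, `Huybrechts_K3_hodgeTypes_H2`,
  `Grothendieck1969_supportedClasses_le_hodgeConiveau`), and
* from X + Lefschetz `(1,1)` for K3 surfaces + `K3TwoSelfSimilar` (every projective K3 surface
  carries a `ℂ`-linear `Ξ` of `H²(S(ℂ); ℂ)` preserving rational classes with `(Ξx ∪ Ξy) = 2(x ∪ y)`;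
  `realMultiplicationSqrtTwoAlgebraic_of_twoSelfSimilar`, seat 13681-2), Lefschetz `(1,1)` serving
  only the two DEGENERATE branches of that proof (`h^{2,0} = 0`, or `eσ = 0` for the `(2,0)`-class `σ`).

This file removes Lefschetz `(1,1)` from the second form, using three results that are now THEOREMS
of the tree: a K3 surface has a non-zero `(2,0)`-class (`IsK3Surface.exists_isOfHodgeType_twoZero_ne_zero`
fed with `Voisin2002_closedForm_top_zero_not_exact_holds`), the Hodge types of `H²(K3)`
(`Huybrechts_K3_hodgeTypes_H2_holds`: the `(1,1)`-classes are exactly the classes orthogonal to `σ`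
and `σ̄`), and "algebraic divisor classes are of type `(1,1)`" for every smooth projective surface
(`isOfHodgeType_oneOne_of_mem_algebraicClasses_of_deRham` fed with the tree's de Rham theorem
`exists_deRhamIsoFamily_holds`; the item `AlgebraicClassesOneOneK3`).
With them BOTH degenerate branches are contradictory: `σ ≠ 0` exists, and `NS = algebraicClasses S 1`
is of type `(1,1)`, hence orthogonal to `σ`, so `σ ∈ NS^⊥` and `e(eσ) = 2σ ≠ 0` forces `eσ ≠ 0`.
The main branch is the mirror argument of `realMultiplicationSqrtTwo_algebraic_of_twoSelfSimilitude`
verbatim (Witt correction `ν̃` from `Ξ`, X at the pair `(S, S)` for `Ξ₁ = e + ν̃` and `Ξ₂ = −e + ν̃`,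
`e = ½(Ξ₁ − Ξ₂)`).

Results:

* `realMultiplicationSqrtTwo_algebraic_of_twoSelfSimilitude_k3` — ONE projective K3 surface `S`:
  X at the pair `(S, S)` and a rational `2`-self-similitude `Ξ` of `H²(S)` make real multiplication
  by `√2` algebraic (no Lefschetz `(1,1)`, no marking);
* `realMultiplicationSqrtTwoAlgebraic_of_twinSimilitude_of_twoSelfSimilar` — the route decl BY NAME
  from X and `K3TwoSelfSimilar` (spelled in the route's vocabulary), nothing else;
* `realMultiplicationSqrtTwoAlgebraic_of_twinSimilitude_of_marking` — the route decl from X and the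
  ONE named fact `Huybrechts_K3_marking_exists` (through `k3TwoSelfSimilar_of_marking`), superseding
  the three-fact form `realMultiplicationSqrtTwoAlgebraic_of_facts` and the Lefschetz-dependent
  `realMultiplicationSqrtTwoAlgebraic_of_marking`.

So the item stmt-HodgeConjecture-13679 is now: X (stmt-HodgeConjecture-13674, used at the pairs
`(S, S)` only; an open sub-case of the Hodge conjecture) + `K3TwoSelfSimilar` (a property of the
rational quadratic space `(H²(S, ℚ), ∪)`, implied by the marking fact, and by `b₂ = 22`, evenness,
index `−16` through `twoSelfSimilar_of_invariants`). Everything here is proved; no named fact is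
introduced. Prover seat prover-pitem-stmt-HodgeConjecture-13679-3.

## References

* [Varesco2023] M. Varesco, Math. Z. 305 (2023), Thm. 2.1, Rem. 2.2.
* [Huybrechts2019] D. Huybrechts, Comment. Math. Helv. 94 (2019), §1.
* [Huybrechts2016K3] D. Huybrechts, Lectures on K3 Surfaces, CUP 2016, Ch. 1 (2.7), Ch. 3 Def. 2.3,
  Ch. 6 Prop. 1.2.
* [VoisinHodgeI2002] C. Voisin, Hodge Theory and Complex Algebraic Geometry I, CUP 2002, Cor. 7.6,
  Prop. 11.20.
-/

noncomputable section

-- `Summit.HodgeConjecture.HodgeConjecture.Theorems` is the mandated namespace (single-problem summit: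
-- Problem = Summit), which `linter.dupNamespace` flags; the lakefile turns the linter off tree-wide
-- (weak option), restated here so stand-alone elaboration is warning-free too.
set_option linter.dupNamespace false

namespace Summit.HodgeConjecture.HodgeConjecture.Theorems.NikulinTwinTransport

open scoped Manifold
open CategoryTheory Module MonoidalCategory
open Literature.AlgebraicGeometry Literature.AlgebraicGeometry.Motives
open Literature.AlgebraicGeometry.HodgeTheory Literature.AlgebraicGeometry.Surfaces
open Literature.Geometry.Kaehler
open Literature.AlgebraicTopology.SingularHomology
open Literature.NumberTheory.Transcendental (exists_deRhamIsoFamily_holds)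

section PerSurface

variable {S : SchemeOver ℂ}

/-- **Real multiplication by `√2` on ONE projective K3 surface `S` is algebraic, granted X at the
pair `(S, S)` and a rational `2`-self-similitude `Ξ` of `(H²(S(ℂ); ℂ), ∪)`** — the Lefschetz-free
form of `realMultiplicationSqrtTwo_algebraic_of_twoSelfSimilitude`.
Proof. Take the integral marking `η, G, p₀` of the smooth projective surface `S`
(`exists_integralMarking`), a Hodge model `A`, and a non-zero `(2,0)`-class `σ`
(`IsK3Surface.exists_isOfHodgeType_twoZero_ne_zero`, Voisin I Cor. 7.6 being the tree's
`Voisin2002_closedForm_top_zero_not_exact_holds`); `H^{2,0} = ℂσ`, `H^{0,2} = ℂσ̄`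
(`IsK3Surface.hodgeTypes_twoZero_zeroTwo`). Divisor classes are of type `(1,1)`
(`isOfHodgeType_oneOne_of_mem_algebraicClasses_of_deRham` with `exists_deRhamIsoFamily_holds`), hence orthogonal to `σ` and `σ̄`
(`Huybrechts_K3_hodgeTypes_H2_holds`), so `σ ∈ NS^⊥` and `e(eσ) = 2σ`; as `eσ = lσ` (type `(2,0)` is
a line preserved by `e`), `l ≠ 0`. A rational `e` commutes with conjugation, so `eσ̄ = l̄σ̄`,
`l̄ ≠ 0`. Then the Witt correction `ν̃ = Σᵢ (·.aᵢ) bᵢ` of `exists_wittCorrection` (built from `Ξ`;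
`aᵢ, bᵢ ∈ NS` rational) makes `Ξ₁ = e + ν̃` and its mirror `Ξ₂ = −e + ν̃` rational, type-preserving
`2`-similitudes of `H²(S)` (`isOfHodgeType_add_correction'`, `cupProduct_neg_add_correction_eq'`);
X at `(S, S)` gives algebraic `γ₁, γ₂` with `Ξᵢ = [γᵢ]_*`, and `e = ½(Ξ₁ − Ξ₂) = [½(γ₁ − γ₂)]_*`.
[cite: Varesco2023, Thm. 2.1 and Rem. 2.2] [cite: Huybrechts2019, §1]
[cite: Huybrechts2016K3, Ch. 6 Prop. 1.2] [cite: VoisinHodgeI2002, Cor. 7.6 and Prop. 11.20] -/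
theorem realMultiplicationSqrtTwo_algebraic_of_twoSelfSimilitude_k3
    (μ : OrientationFamily) (S : SchemeOver ℂ) (hS : IsK3Surface S)
    (Ξ : complexBetti S (2 * 1) →ₗ[ℂ] complexBetti S (2 * 1))
    (hΞrat : ∀ x, IsRationalClass x → IsRationalClass (Ξ x))
    (hΞ2 : ∀ x y : complexBetti S (2 * 1), cupProduct (rfl : 2 * 1 + 2 * 1 = 2 * 2) (Ξ x) (Ξ y) =
      (2 : ℂ) • cupProduct (rfl : 2 * 1 + 2 * 1 = 2 * 2) x y)
    (hX : ∀ (p : complexBetti S (2 * 2)),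
      (IsIntegralClass p ∧ ∀ q : complexBetti S (2 * 2), IsIntegralClass q → ∃ n : ℤ, q = n • p) →
      ∀ (ψ : complexBetti S (2 * 1) →ₗ[ℂ] complexBetti S (2 * 1)),
        (∀ x, IsRationalClass x → IsRationalClass (ψ x)) →
        (∀ (i j : ℕ) x, IsOfHodgeType 2 S (2 * 1) i j x → IsOfHodgeType 2 S (2 * 1) i j (ψ x)) →
        (∀ (x y : complexBetti S (2 * 1)) (a : ℂ),
          cupProduct (rfl : 2 * 1 + 2 * 1 = 2 * 2) x y = a • p →
            cupProduct (rfl : 2 * 1 + 2 * 1 = 2 * 2) (ψ x) (ψ y) = ((2 : ℂ) * a) • p) →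
        ∃ γ ∈ algebraicClasses (S ⊗ S) 2, ∀ x : complexBetti S (2 * 1),
          ψ x = complexGysin μ (IsSmoothProjective.tensor_holds hS.1 hS.1) hS.1
            (SemiCartesianMonoidalCategory.fst S S)
            (rfl : 2 * 1 + 2 * 2 + 2 * 2 = 2 * 1 + 2 * (2 + 2))
            (cupProduct (rfl : 2 * 1 + 2 * 2 = 2 * 1 + 2 * 2)
              (complexBetti.map (SemiCartesianMonoidalCategory.snd S S) (2 * 1) x) γ))
    (e : complexBetti S (2 * 1) →ₗ[ℂ] complexBetti S (2 * 1))
    (he_rat : ∀ x, IsRationalClass x → IsRationalClass (e x))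
    (he_type : ∀ (i j : ℕ) x, IsOfHodgeType 2 S (2 * 1) i j x → IsOfHodgeType 2 S (2 * 1) i j (e x))
    (he_adj : ∀ x y : complexBetti S (2 * 1),
      cupProduct (rfl : 2 * 1 + 2 * 1 = 2 * 2) (e x) y = cupProduct (rfl : 2 * 1 + 2 * 1 = 2 * 2) x (e y))
    (he_N : ∀ d ∈ algebraicClasses S 1, e d = 0)
    (he_T : ∀ x : complexBetti S (2 * 1),
      (∀ d ∈ algebraicClasses S 1, cupProduct (rfl : 2 * 1 + 2 * 1 = 2 * 2) x d = 0) →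
        e (e x) = (2 : ℂ) • x) :
    ∃ γ ∈ algebraicClasses (S ⊗ S) 2, ∀ x : complexBetti S (2 * 1),
      e x = complexGysin μ (IsSmoothProjective.tensor_holds hS.1 hS.1) hS.1
        (SemiCartesianMonoidalCategory.fst S S)
        (rfl : 2 * 1 + 2 * 2 + 2 * 2 = 2 * 1 + 2 * (2 + 2))
        (cupProduct (rfl : 2 * 1 + 2 * 2 = 2 * 1 + 2 * 2)
          (complexBetti.map (SemiCartesianMonoidalCategory.snd S S) (2 * 1) x) γ) := by
  classical
  -- the integral marking of the smooth projective surface `S`, and a Hodge model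
  obtain ⟨n, η, G, p₀, hp₀, hp₀int, hp₀gen, hGt, hGdet, hηint, hηcup⟩ := exists_integralMarking hS.1
  obtain ⟨A⟩ := hS.nonempty_hodgeModel
  set Bc := Matrix.toBilin' (G.map (Int.cast : ℤ → ℂ)) with hBc
  have hBcs : Bc.IsSymm := isSymm_toBilin'_map G hGt
  -- the cup product on `H²` is symmetric (through the marking)
  have hcomm : ∀ x y : complexBetti S (2 * 1),
      cupProduct (rfl : 2 * 1 + 2 * 1 = 2 * 2) x y = cupProduct (rfl : 2 * 1 + 2 * 1 = 2 * 2) y x := by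
    intro x y
    rw [hηcup, hηcup, hBcs.eq]
  /- a non-zero `(2,0)`-class `σ` (Voisin I Cor. 7.6, proved), and the two lines `ℂσ`, `ℂσ̄` -/
  obtain ⟨σ, hσ0, h20⟩ := hS.exists_isOfHodgeType_twoZero_ne_zero
    (fun E _ _ _ M _ _ => Voisin2002_closedForm_top_zero_not_exact_holds E M)
  obtain ⟨h1, h2⟩ := hS.hodgeTypes_twoZero_zeroTwo h20 hσ0
  set σ' := conjClass (ComplexPoints S) (2 * 1) σ with hσ'
  have hσ'0 : σ' ≠ 0 := fun h0 => hσ0 (by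
    rw [← conjClass_conjClass σ, ← hσ', h0, conjClass_zero])
  have h02 : IsOfHodgeType 2 S (2 * 1) 0 2 σ' := (h2 _).2 ⟨1, (one_smul ℂ _).symm⟩
  -- divisor classes are of type `(1,1)` (Voisin I Prop. 11.20 for surfaces, proved), hence `⊥ σ, σ̄`
  have hN11 : ∀ d ∈ algebraicClasses S 1, IsOfHodgeType 2 S (2 * 1) 1 1 d := fun d hd =>
    isOfHodgeType_oneOne_of_mem_algebraicClasses_of_deRham (fun E _ _ _ => exists_deRhamIsoFamily_holds E)
      hS.1 hd
  have horth : ∀ d ∈ algebraicClasses S 1,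
      cupProduct (rfl : 2 * 1 + 2 * 1 = 2 * 2) d σ = 0 ∧
        cupProduct (rfl : 2 * 1 + 2 * 1 = 2 * 2) d σ' = 0 := fun d hd =>
    ((Huybrechts_K3_hodgeTypes_H2_holds S hS σ h20 hσ0).2.2 d).1 (hN11 d hd)
  -- `σ ∈ NS^⊥`, so `e (e σ) = 2 σ`
  have heeσ : e (e σ) = (2 : ℂ) • σ :=
    he_T σ fun d hd => by rw [hcomm, (horth d hd).1]
  -- `e σ = l σ`, `e σ̄ = l̄ σ̄` (a rational `e` commutes with conjugation), and `l ≠ 0`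
  obtain ⟨l, hl⟩ := (h1 (e σ)).1 (he_type 2 0 _ h20)
  have hl' : e σ' = (starRingEnd ℂ l) • σ' := by
    rw [hσ', ← conjClass_apply_of_isRationalClass η hηint e he_rat σ, hl, conjClass_smul]
  have hl0 : l ≠ 0 := by
    rintro rfl
    rw [zero_smul] at hl
    rw [hl, map_zero] at heeσ
    exact hσ0 ((smul_eq_zero.1 heeσ.symm).resolve_left two_ne_zero)
  have hl'0 : starRingEnd ℂ l ≠ 0 := fun h => hl0 (by simpa using h)
  -- in coordinates: `(σ.d) = (σ̄.d) = 0` for `d ∈ NS`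
  have horth' : ∀ d ∈ algebraicClasses S 1, Bc (η σ) (η d) = 0 ∧ Bc (η σ') (η d) = 0 := by
    intro d hd
    obtain ⟨hd1, hd2⟩ := horth d hd
    rw [hηcup, smul_eq_zero] at hd1 hd2
    exact ⟨by rw [hBcs.eq]; exact hd1.resolve_right hp₀, by rw [hBcs.eq]; exact hd2.resolve_right hp₀⟩
  -- the Witt correction from `Ξ`
  obtain ⟨m, a, b, ha, hb, -, -, hν'⟩ :=
    exists_wittCorrection hS.1 η G p₀ hp₀ hGt hGdet hηint hηcup Ξ hΞrat hΞ2 e he_rat he_adj he_N he_T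
  -- the correction `ν̃ = Σᵢ (η(·)ᵀ G η(aᵢ)) bᵢ` as a linear map
  set ψ : Fin m → (complexBetti S (2 * 1) →ₗ[ℂ] complexBetti S (2 * 1)) := fun i =>
    ((Bc.flip (η (a i))) ∘ₗ η.toLinearMap).smulRight (b i) with hψdef
  have hψ : ∀ i x, ψ i x = Bc (η x) (η (a i)) • b i := by
    intro i x
    rw [hψdef]
    change ((Bc.flip (η (a i))) ∘ₗ η.toLinearMap) x • b i = _
    rw [LinearMap.comp_apply, LinearEquiv.coe_coe, LinearMap.BilinForm.flip_apply]
  set ν : complexBetti S (2 * 1) →ₗ[ℂ] complexBetti S (2 * 1) := ∑ i, ψ i with hνdef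
  have hν : ∀ x, ν x = ∑ i, Bc (η x) (η (a i)) • b i := by
    intro x
    rw [hνdef, LinearMap.sum_apply]
    exact Finset.sum_congr rfl fun i _ => hψ i x
  obtain ⟨hrat₁, hcup₁⟩ := hν' ν hν
  have heb : ∀ i, e (b i) = 0 := fun i => he_N _ (hb i)
  have hν0 : ν σ = 0 := by
    rw [hν]
    exact Finset.sum_eq_zero fun i _ => by rw [(horth' _ (ha i)).1, zero_smul]
  have hν0' : ν σ' = 0 := by
    rw [hν]
    exact Finset.sum_eq_zero fun i _ => by rw [(horth' _ (ha i)).2, zero_smul]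
  -- X at the pair `(S, S)` for `Ξ₁ = e + ν̃`
  obtain ⟨γ₁, hγ₁, hΞ₁⟩ := hX p₀ ⟨hp₀int, hp₀gen⟩ (e + ν) hrat₁
    (isOfHodgeType_add_correction' hS.1 A h1 h2 e ν he_type (fun x i => Bc (η x) (η (a i))) b hν hν0
      hν0' (fun i => hN11 _ (hb i)))
    (fun x y c hxy => by rw [hcup₁ x y, hxy, smul_smul])
  -- X at the pair `(S, S)` for the mirror `Ξ₂ = -e + ν̃`
  obtain ⟨γ₂, hγ₂, hΞ₂⟩ := hX p₀ ⟨hp₀int, hp₀gen⟩ (-e + ν)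
    (fun x hx => by
      have hx2 : (-e + ν) x = (e + ν) x + ((-2 : ℚ) : ℂ) • e x := by
        rw [LinearMap.add_apply, LinearMap.neg_apply, LinearMap.add_apply, Rat.cast_neg,
          Rat.cast_ofNat]
        module
      rw [hx2]
      exact (hrat₁ x hx).add ((he_rat x hx).smul _))
    (isOfHodgeType_add_correction' hS.1 A h1 h2 (-e) ν
      (fun i j x hx => by rw [LinearMap.neg_apply]; exact (he_type i j x hx).neg)
      (fun x i => Bc (η x) (η (a i))) b hν hν0 hν0' (fun i => hN11 _ (hb i)))
    (fun x y c hxy => by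
      rw [cupProduct_neg_add_correction_eq' e ν he_adj (fun x i => Bc (η x) (η (a i))) b hν heb x y,
        hcup₁ x y, hxy, smul_smul])
  -- `e = ½ (Ξ₁ − Ξ₂)`
  have h := induced_smul (IsSmoothProjective.tensor_holds hS.1 hS.1) hS.1
    (rfl : 2 * 1 + 2 * 2 = 2 * 1 + 2 * 2) (rfl : 2 * 1 + 2 * 2 + 2 * 2 = 2 * 1 + 2 * (2 + 2))
    (1 / 2 : ℂ)
    (induced_sub (IsSmoothProjective.tensor_holds hS.1 hS.1) hS.1
      (rfl : 2 * 1 + 2 * 2 = 2 * 1 + 2 * 2) (rfl : 2 * 1 + 2 * 2 + 2 * 2 = 2 * 1 + 2 * (2 + 2))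
      ⟨γ₁, hγ₁, hΞ₁⟩ ⟨γ₂, hγ₂, hΞ₂⟩)
  have he : (1 / 2 : ℂ) • ((e + ν) - (-e + ν)) = e := by
    rw [show (e + ν) - (-e + ν) = (2 : ℂ) • e by module, smul_smul]
    norm_num
  rwa [he] at h

end PerSurface

/-! ### The route decl from X and `K3TwoSelfSimilar`, and from X and the marking fact -/

/-- **`RealMultiplicationSqrtTwoAlgebraic` (item stmt-HodgeConjecture-13679, the route decl by name)
from X = Sim₂(K3) (at the pairs `(S, S)` only) and the rational `2`-self-similitude of `H²` of every
projective K3 surface** — nothing else: no Lefschetz `(1,1)`, no marking, no named fact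
(`realMultiplicationSqrtTwo_algebraic_of_twoSelfSimilitude_k3` surface by surface; the hypothesis
`hΞ` is written in the route's vocabulary with `IsK3Surface` unfolded).
[cite: Varesco2023, Thm. 2.1 and Rem. 2.2] [cite: Huybrechts2019, §1] -/
theorem realMultiplicationSqrtTwoAlgebraic_of_twinSimilitude_of_twoSelfSimilar
    (hX : Theses.NikulinTwinTransport.TwinSimilitudeAlgebraic)
    (hΞ : ∀ (S : Literature.AlgebraicGeometry.Motives.SchemeOver ℂ),
      (Literature.AlgebraicGeometry.Motives.IsSmoothProjective 2 S ∧
        Subsingleton (Literature.AlgebraicGeometry.Motives.structureSheafCohomology S.left 1) ∧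
        ∃ (A : Literature.AlgebraicGeometry.HodgeTheory.HodgeModel 2 S)
          (η : Literature.Geometry.Kaehler.MForm 𝓘(ℝ, A.model) A.carrier ℂ 2),
          Literature.Geometry.Kaehler.IsHolomorphicInCharts η ∧ ∀ x, η x ≠ 0) →
      ∃ Ξ : Literature.AlgebraicGeometry.HodgeTheory.complexBetti S (2 * 1) →ₗ[ℂ]
          Literature.AlgebraicGeometry.HodgeTheory.complexBetti S (2 * 1),
        (∀ x, Literature.AlgebraicGeometry.HodgeTheory.IsRationalClass x →
          Literature.AlgebraicGeometry.HodgeTheory.IsRationalClass (Ξ x)) ∧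
        ∀ x y : Literature.AlgebraicGeometry.HodgeTheory.complexBetti S (2 * 1),
          Literature.AlgebraicTopology.SingularHomology.cupProduct (rfl : 2 * 1 + 2 * 1 = 2 * 2) (Ξ x) (Ξ y) =
            (2 : ℂ) • Literature.AlgebraicTopology.SingularHomology.cupProduct (rfl : 2 * 1 + 2 * 1 = 2 * 2) x y) :
    Theses.NikulinTwinTransport.RealMultiplicationSqrtTwoAlgebraic :=
  fun μ _ S hS e he_rat he_type he_adj he_N he_T => by
    obtain ⟨Ξ, hΞrat, hΞ2⟩ := hΞ S hS
    exact realMultiplicationSqrtTwo_algebraic_of_twoSelfSimilitude_k3 μ S hS Ξ hΞrat hΞ2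
      (fun p hp ψ => hX μ ‹_› S S hS hS p p hp hp ψ) e he_rat he_type he_adj he_N he_T

/-- **`RealMultiplicationSqrtTwoAlgebraic` (item stmt-HodgeConjecture-13679) from X = Sim₂(K3) and the
ONE named fact `Huybrechts_K3_marking_exists`** (Huybrechts Ch. 1 Prop. 3.5: the marking yields the
rational `2`-self-similitude `Ξ = η⁻¹ M η`, `k3TwoSelfSimilar_of_marking`). Supersedes the three-fact
closing form `realMultiplicationSqrtTwoAlgebraic_of_facts` (the Hodge types of `H²(K3)` and the
coniveau inclusion for divisors are now theorems) and the Lefschetz-dependent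
`realMultiplicationSqrtTwoAlgebraic_of_marking`. [cite: Varesco2023, Thm. 2.1 and Rem. 2.2]
[cite: Huybrechts2016K3, Ch. 1 Prop. 3.5] -/
theorem realMultiplicationSqrtTwoAlgebraic_of_twinSimilitude_of_marking
    (hX : Theses.NikulinTwinTransport.TwinSimilitudeAlgebraic)
    (hmark : Huybrechts_K3_marking_exists) :
    Theses.NikulinTwinTransport.RealMultiplicationSqrtTwoAlgebraic :=
  realMultiplicationSqrtTwoAlgebraic_of_twinSimilitude_of_twoSelfSimilar hX
    fun S hS => k3TwoSelfSimilar_of_marking hmark S hS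

end Summit.HodgeConjecture.HodgeConjecture.Theorems.NikulinTwinTransport

end
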